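import Mathlib
import HarnessLib
import Literature.AlgebraicGeometry.Resolution.CobordantBlowupFiltration
import Summits.ResolutionOfSingularities.ResolutionOfSingularities.Theorems.WildQuotientsWildQuotientResolutionS1aOneShotKill

/-!
# S1a — (T2c)(T2d)(T2) the ONE-SHOT KILL in ring form: unit-successor formula, cover, and the composite

[OURS · L1 W4.5c · lead-1 g6, after plan-1 g11's SIG `L/w45c/W45cT2Signatures.lean` f384756d9d5bd870 (T2c, T2d,
`OneShotKillRing`) and memo `L/w45c/T2-THEOREM-SHEET.md`] — NOT statements of the manuscript; counted 0; AI-level work,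
weaker than expert review. Crux stmt-ResolutionOfSingularities-17941, line `s1a-logminvertex` v6, stub `stub_winningStrategy`
((R0) one-shot branch). `K n` below is the treeʼs `(weightedFiltration f w).ideal n`.

* `unitSuccessorFormula` (T2c) — in a `B`-algebra `C` with `f j ↦ g j * e ^ (w j)`, `K n ↦ (eⁿ)`, `e` a non-zero-divisor
  fixed by `τ`: a unit-successor relation `σ (f h) − f h − u f i ∈ K (w h + 2)`, `w i = w h + 1`, descends to
  `τ (g h) − g h − u g i e ∈ (e²)` (cancel `e ^ (w h)`);
* `isUnit_mk_span_of_isUnit_mk` — a unit modulo `K 1` maps to a unit modulo `e`;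
* `cover_of_isUnit` (T2d) — if the chart element `b ∈ K m` becomes a unit and `K m ↦ (g)`, the `g j` generate `C`;
* **`oneShotKillRing`** (T2 = T2a ∘ T2c) — for a depth-weighted centre with (D0) `I_σ = K 1`, (D1) DEPTH, (D2) HEADS or
  UNIT SUCCESSORS, the compatible automorphism `τ` of any such chart ring has `augmentationIdeal τ = (e)` — the
  Király–Lütkebohmert KILL along the whole exceptional divisor of the chart.
-/

set_option linter.dupNamespace false

noncomputable section

open Literature.AlgebraicGeometry.Resolution

namespace Summit.ResolutionOfSingularities.ResolutionOfSingularities.Theorems.WildQuotientResolution.S1.OneShotKill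

universe u v

variable {B C : Type u} [CommRing B] [CommRing C] [Algebra B C] (σ : B ≃+* B) (τ : C ≃+* C)
  {ι : Type v} (f : ι → B) (w : ι → ℕ) (g : ι → C) (e : C)

/-- **(T2c) UNIT-SUCCESSOR FORMULA.** [OURS · L1 W4.5c] -/
theorem unitSuccessorFormula (hcompat : ∀ b : B, τ (algebraMap B C b) = algebraMap B C (σ b))
    (he : e ∈ nonZeroDivisors C) (hτe : τ e = e) (hfg : ∀ j, algebraMap B C (f j) = g j * e ^ (w j))
    (hK : ∀ (n : ℕ) (y : B), y ∈ (weightedFiltration f w).ideal n → algebraMap B C y ∈ Ideal.span {e ^ n})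
    (h i : ι) (u : B) (hw : w i = w h + 1)
    (hrel : σ (f h) - f h - u * f i ∈ (weightedFiltration f w).ideal (w h + 2)) :
    τ (g h) - g h - algebraMap B C u * g i * e ∈ Ideal.span {e ^ 2} := by
  obtain ⟨z, hz⟩ := Ideal.mem_span_singleton'.mp (hK _ _ hrel)
  rw [map_sub, map_sub, map_mul, ← hcompat, hfg h, hfg i, hw, map_mul, map_pow, hτe] at hz
  -- `hz : z * e ^ (w h + 2) = τ (g h) * e ^ w h - g h * e ^ w h - algebraMap u * (g i * e ^ (w h + 1))`
  refine Ideal.mem_span_singleton'.mpr ⟨z, ?_⟩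
  have hewh : e ^ w h ∈ nonZeroDivisors C := pow_mem he (w h)
  refine (mul_cancel_right_mem_nonZeroDivisors hewh).mp ?_
  rw [show z * e ^ 2 * e ^ w h = z * e ^ (w h + 2) by ring, hz]
  ring

/-- A unit modulo `K 1` maps to a unit modulo `e` (since `K 1 ↦ (e)`). -/
theorem isUnit_mk_span_of_isUnit_mk
    (hK : ∀ (n : ℕ) (y : B), y ∈ (weightedFiltration f w).ideal n → algebraMap B C y ∈ Ideal.span {e ^ n})
    {u : B} (hu : IsUnit (Ideal.Quotient.mk ((weightedFiltration f w).ideal 1) u)) :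
    IsUnit (Ideal.Quotient.mk (Ideal.span {e}) (algebraMap B C u)) := by
  obtain ⟨v', hv'⟩ := hu.exists_right_inv
  obtain ⟨v, rfl⟩ := Ideal.Quotient.mk_surjective v'
  rw [← map_mul, ← map_one (Ideal.Quotient.mk _), Ideal.Quotient.eq] at hv'
  have h1 : algebraMap B C (u * v - 1) ∈ Ideal.span {e} := by
    have := hK 1 _ hv'; rwa [pow_one] at this
  rw [map_sub, map_one, map_mul] at h1
  refine isUnit_iff_exists_inv.mpr ⟨Ideal.Quotient.mk (Ideal.span {e}) (algebraMap B C v), ?_⟩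
  rw [← map_mul, ← map_one (Ideal.Quotient.mk _), Ideal.Quotient.eq]
  exact h1

/-- **(T2d) COVER**: the strict-transform coordinates generate the unit ideal of a chart ring in which the chart
element `b ∈ K m` is a unit and `K m ↦ (g)`. [OURS · L1 W4.5c] -/
theorem cover_of_isUnit {m : ℕ} {b : B} (hb : b ∈ (weightedFiltration f w).ideal m) (hunit : IsUnit (algebraMap B C b))
    (hKm : ∀ y : B, y ∈ (weightedFiltration f w).ideal m → algebraMap B C y ∈ Ideal.span (Set.range g)) :
    Ideal.span (Set.range g) = ⊤ :=
  Ideal.eq_top_of_isUnit_mem _ (hKm b hb) hunit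

/-- **(T2) ONE-SHOT KILL, ring form** (T2a ∘ T2c): for a depth-weighted centre `(f, w)` in `B` with (D0) `I_σ = K 1`,
(D1) `σ (f i) − f i ∈ K (w i + 1)` and (D2) every `f i` a HEAD or a UNIT SUCCESSOR, the compatible automorphism `τ` of a
chart ring `C` (`e` a `τ`-fixed non-zero-divisor, `f j ↦ g j e^{w j}`, `K n ↦ (eⁿ)`, `(g) = C`, gr-triviality
`τ x − x ∈ (e)`) satisfies `augmentationIdeal τ = (e)`. [OURS · L1 W4.5c] -/
theorem oneShotKillRing [Finite ι] (hcompat : ∀ b : B, τ (algebraMap B C b) = algebraMap B C (σ b))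
    (hw : ∀ i, 0 < w i) (he : e ∈ nonZeroDivisors C) (hτe : τ e = e)
    (hfg : ∀ j, algebraMap B C (f j) = g j * e ^ (w j))
    (hK : ∀ (n : ℕ) (y : B), y ∈ (weightedFiltration f w).ideal n → algebraMap B C y ∈ Ideal.span {e ^ n})
    (hcov : Ideal.span (Set.range g) = ⊤) (hgr : ∀ x : C, τ x - x ∈ Ideal.span {e})
    (hD0 : augmentationIdeal σ = (weightedFiltration f w).ideal 1)
    (hD2 : ∀ i, w i = 1 ∨ ∃ (h : ι) (u : B), w i = w h + 1 ∧
      IsUnit (Ideal.Quotient.mk ((weightedFiltration f w).ideal 1) u) ∧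
      σ (f h) - f h - u * f i ∈ (weightedFiltration f w).ideal (w h + 2)) :
    augmentationIdeal τ = Ideal.span {e} := by
  refine augmentationIdeal_eq_span_of_oneShot σ τ hcompat g w e hcov (fun i => ⟨hw i, ?_⟩) hgr fun i => ?_
  · -- `g i * e ^ (w i) = f i ∈ K (w i) ⊆ K 1 = I_σ`
    rw [← hfg i, hD0]
    exact Ideal.mem_map_of_mem _
      ((weightedFiltration f w).antitone (hw i) (mem_weightedFiltration_ideal f w i))
  · rcases hD2 i with hhead | ⟨h, u, hwi, hu, hrel⟩
    · exact Or.inl hhead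
    · exact Or.inr ⟨h, algebraMap B C u, isUnit_mk_span_of_isUnit_mk f w e hK hu,
        unitSuccessorFormula σ τ f w g e hcompat he hτe hfg hK h i u hwi hrel⟩

end Summit.ResolutionOfSingularities.ResolutionOfSingularities.Theorems.WildQuotientResolution.S1.OneShotKill

end
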